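import Summits.BirchSwinnertonDyer.BirchSwinnertonDyer.Theorems.ByReductionTypeAtTwoTowerNoFiniteSubmoduleOfCasselsTatePackage
import Literature.NumberTheory.EllipticCurves.SubgroupSelmerCorestrictionProofs
import HarnessLib

/-!
# Route `ByReductionTypeAtTwo`, TOWER road (items 19271 / 19573 / 19922 / 19923): the PRINT binder `h414`
# (Greenberg LNM 1716 Prop. 4.14 = `Greenberg1999.prop414_noFiniteSubmodule_of_not_dvd_torsionOrder`) on the
# HACHIMORI–MATSUNO ROAD — the CORESTRICTIONS now KERNEL (`WeierstrassCurve.coresLayer`); displayed residue =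
# the Cassels–Tate layer pairings alone ([HachimoriMatsuno2000, p. 2540 L34–37], Milne *ADT* I §6)

HONEST FRAMING (cell `bsd-2adic`, run/shared/lean/pub/bsd-2adic/, seat `bsd-2adic-tower-1` GEN 22, HUMAN RULINGS D-0036 /
D-0054 / D-0074; D-0152: kernel hygiene on a CLASS-route hypothesis, no kit, no desk object): theorems only (no definition, no
named fact, no `sorry`, axioms the standard trio); CONDITIONAL on the displayed pairings; closes no route item; nothing booked;
BSD is not proved by any of this. `h414` stays displayed on the 429 K4 TOWER / λ-rank files (no re-key from this seat).

WHAT IT PROVES. Third step of the road GEN 21 `…TowerNoFiniteSubmoduleOfLayerPackage` (injectivity, transitions, exhaustion,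
`Γ`-action kernel) → GEN 22 `…OfCasselsTatePackage` (stabilisation and `conj_γ`-stability of the divisible parts kernel) → HERE:
the corestrictions `cor_{K_{n+1}/K_n} : Sel_{p^∞}(E/K_{n+1}) → Sel_{p^∞}(E/K_n)` of the package are no longer displayed — they are
the tree's KERNEL corestrictions `WeierstrassCurve.coresLayer W p κ n` (`Literature/…/SubgroupSelmerCorestrictionProofs`:
transfer on continuous cocycles; `coresLayer_mem_selmerLayer`: `cor(Sel_{n+1}) ⊆ Sel_n` by Clark–Sharif's local triviality of
corestriction; `layerToInfty_coresLayer`: `res_∞ ∘ cor = Σ_{i<p} conj_{γ^{pⁿ i}} ∘ res_∞`, the norm of `Gal(K_{n+1}/K_n) = ⟨γ^{pⁿ}⟩`).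
What stays DISPLAYED is exactly the Cassels–Tate layer pairing of [HachimoriMatsuno2000, p. 2540 L34–37] ("There exists a
non-degenerate skew-symmetric Galois-equivariant pairing `C_n × C_n → ℚ_p/ℤ_p` (cf. [Milne, ADT, I §6]). Furthermore, the dual
of the restriction map `C_n → C_{n+1}` under this pairing is the corestriction map `C_{n+1} → C_n`"): biadditive pairings
`⟨·,·⟩_n` on `Sel_{p^∞}(E/K_n)` which are skew-symmetric, `conj_γ`-invariant, with `p`-divisible right kernel and every character
vanishing on it represented (= lifted from a non-degenerate pairing on `C_n = Sel/D_n`, `D_n` the maximal divisible subgroup),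
and ADJOINTNESS `⟨y, cor t⟩_n = ⟨res y, t⟩_{n+1}` with respect to the KERNEL maps `coresLayer` / `resOfLe` (pinned by values).

* §1 `SelmerDualData.forall_finite_eq_bot_of_casselsTatePairings` — any `K`, `p`, `ℤ_p`-extension `κ` with topological
  generator `γ`, `E(K)[p] = 0`, any dual datum with `X` finitely generated `Λ`-torsion: CT layer pairings ⟹ no non-zero finite
  `Λ`-submodule.
* §2 `prop414_of_casselsTatePairings` — over `ℚ`: CT layer pairings for every (globally minimal elliptic `W`, `p ∤ #E(ℚ)_tors`,
  cyclotomic `κ`, `γ`) ⟹ the Literature named fact `prop414_noFiniteSubmodule_of_not_dvd_torsionOrder` (binder `h414`).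
  So `h414 = PRINT{Cassels–Tate pairing on Ш(E/ℚ_n)[p^∞]/div: non-degenerate, skew-symmetric, Galois-equivariant, res† = cor}
  ∘ KERNEL`.

References: [HachimoriMatsuno2000] Theorem, Cor. (i), proof p. 2540 L28–L45; [GreenbergLNM1716] §4 Prop. 4.14 (pp. 104–105);
[MilneADT2006] I Prop. 6.9, Thm. 6.13, Rem. 6.10; [ClarkSharif2010] §3.6; [Washington1997] Prop. 13.28.
-/

set_option autoImplicit false
-- the Theorems namespace of this sub repeats the summit name by design (D-0017 nested layout: Summit.<S>.<Sub>)
set_option linter.dupNamespace false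

noncomputable section

open scoped Classical

universe u

namespace Summit.BirchSwinnertonDyer.BirchSwinnertonDyer.Theorems.TowerHaMa

open NumberField IsDedekindDomain Field WeierstrassCurve Literature.NumberTheory.EllipticCurves
  Literature.NumberTheory.EllipticCurves.ZpExtension Literature.NumberTheory.GaloisRepresentations
  Summit.BirchSwinnertonDyer.Rank1Residual

/-! ## §1 The tree's layers, kernel corestrictions: only the Cassels–Tate layer pairings displayed -/

section Tower

variable {K : Type u} [Field K] [NumberField K] (W : WeierstrassCurve K) [W.IsElliptic] {p : ℕ} [Fact p.Prime]
  (κ : ZpExtension K p) {γ : Field.absoluteGaloisGroup K}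

/-- **Hachimori–Matsuno on the tree's plain Selmer tower with KERNEL corestrictions — only the Cassels–Tate layer pairings
displayed.** For ANY number field `K`, elliptic `W/K` with `E(K)[p] = 0` (`hK`), ANY `ℤ_p`-extension `κ` with topological
generator `γ`, ANY dual datum `D : W.SelmerDualData κ γ` with `D.X` finitely generated and `Λ`-torsion: if the layers
`Sel_{p^∞}(E/K_n)` carry biadditive pairings `⟨·,·⟩_n`, skew-symmetric (`hskew`), `conj_γ`-invariant (`hinv`), with
`p`-divisible right kernel (`hdiv`), every character vanishing on the right kernel represented (`hsurj`), under which
restriction `res_{K_{n+1}/K_n}` (`W.resOfLe`) is adjoint to the KERNEL corestriction `cor_{K_{n+1}/K_n}` (`W.coresLayer`,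
`coresLayer_mem_selmerLayer`) (`hadj`) — then `D.X` has no non-zero finite `Λ`-submodule. The norm relation
`res_∞ ∘ cor = Σ_{i<p} conj_{γ^{pⁿ i}} ∘ res_∞` is the tree theorem `layerToInfty_coresLayer`; everything else as in
`forall_finite_eq_bot_of_casselsTatePackage`. [cite: HachimoriMatsuno2000, Theorem and Corollary (i), proof p. 2540 L28–L45]
[cite: MilneADT2006, I Prop. 6.9, Thm. 6.13 (a)(b), Rem. 6.10] [cite: GreenbergLNM1716, §4 Prop. 4.14 (pp. 104–105)] -/
theorem SelmerDualData.forall_finite_eq_bot_of_casselsTatePairings (hγ : κ.IsTopGenerator γ)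
    (hK : ∀ P : W.toAffine.Point, p • P = 0 → P = 0) (D : W.SelmerDualData κ γ)
    [Module.Finite (IwasawaAlgebra p) D.X] (htor : D.IsTorsion)
    (pair : ∀ n, W.selmerLayer κ n →+ W.selmerLayer κ n →+ AddCircle (1 : ℚ))
    (hskew : ∀ n (y t : W.selmerLayer κ n), pair n y t = -pair n t y)
    (hinv : ∀ n (y t y' t' : W.selmerLayer κ n),
      (y' : W.subgroupH1 p (κ.layerSubgroup n)) = W.conjH1 p (κ.layerSubgroup n) γ y →
      (t' : W.subgroupH1 p (κ.layerSubgroup n)) = W.conjH1 p (κ.layerSubgroup n) γ t → pair n y' t' = pair n y t)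
    (hdiv : ∀ n (t : W.selmerLayer κ n), (∀ y, pair n y t = 0) → ∃ t' : W.selmerLayer κ n, (∀ y, pair n y t' = 0) ∧ p • t' = t)
    (hsurj : ∀ n (g : W.selmerLayer κ n →+ AddCircle (1 : ℚ)),
      (∀ t, (∀ y, pair n y t = 0) → g t = 0) → ∃ c, ∀ y, g y = pair n y c)
    (hadj : ∀ n (t : W.selmerLayer κ (n + 1)) (t' : W.selmerLayer κ n)
      (y : W.selmerLayer κ n) (y' : W.selmerLayer κ (n + 1)),
      (t' : W.subgroupH1 p (κ.layerSubgroup n)) = W.coresLayer p κ n (t : W.subgroupH1 p (κ.layerSubgroup (n + 1))) →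
      (y' : W.subgroupH1 p (κ.layerSubgroup (n + 1))) = W.resOfLe p (κ.layerSubgroup_antitone (Nat.le_succ n)) y →
      pair n y t' = pair (n + 1) y' t) :
    ∀ M : Submodule (IwasawaAlgebra p) D.X, Finite M → M = ⊥ :=
  SelmerDualData.forall_finite_eq_bot_of_casselsTatePackage W κ hγ hK D htor pair hskew hinv hdiv hsurj fun n t ↦
    ⟨⟨W.coresLayer p κ n (t : W.subgroupH1 p (κ.layerSubgroup (n + 1))), W.coresLayer_mem_selmerLayer p κ n t.2⟩,
      W.layerToInfty_coresLayer p κ hγ n _, fun y y' hy' ↦ hadj n t _ y y' rfl hy'⟩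

end Tower

/-! ## §2 Over `ℚ`: the binder `h414` from the Cassels–Tate layer pairings alone -/

/-- **`h414` by the Hachimori–Matsuno road: `h414 = PRINT{Cassels–Tate layer pairings} ∘ KERNEL`.** If, for every globally
minimal elliptic `W/ℚ`, every prime `p` with `p ∤ #E(ℚ)_tors`, every cyclotomic `κ` with topological generator `γ`, the plain
Selmer layers `Sel_{p^∞}(E/ℚ_n)` carry the Cassels–Tate layer pairings of [HachimoriMatsuno2000, p. 2540 L34–37] —
skew-symmetric, Galois-equivariant, non-degenerate on `C_n = Sel(E/ℚ_n)/D_n` (`p`-divisible right kernel, every character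
vanishing on it represented), with restriction adjoint to the (kernel) corestriction — then the Literature named fact
`Greenberg1999.prop414_noFiniteSubmodule_of_not_dvd_torsionOrder` (Greenberg LNM 1716 Prop. 4.14, `F = ℚ`; the PRINT binder
`h414` of the K4 TOWER doors) HOLDS. Kernel: injectivity of the layers, transitions, exhaustion, `Γ`-action, corestrictions
and their norm relation, the divisible parts and their stabilisation. CONDITIONAL; nothing asserted about any curve.
[cite: HachimoriMatsuno2000, Theorem and Corollary (i), proof p. 2540 L28–L45]
[cite: GreenbergLNM1716, §4 Prop. 4.14 (pp. 104–105)] [cite: MilneADT2006, I Prop. 6.9, Thm. 6.13, Rem. 6.10] -/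
theorem prop414_of_casselsTatePairings
    (hCT : ∀ (W : WeierstrassCurve ℚ) [W.IsElliptic] [W.IsGloballyMinimal] (p : ℕ) [Fact p.Prime],
      ¬ p ∣ W.torsionOrder →
      ∀ (κ : ZpExtension ℚ p) (γ : Field.absoluteGaloisGroup ℚ), κ.IsCyclotomic → κ.IsTopGenerator γ →
      ∃ pair : ∀ n, W.selmerLayer κ n →+ W.selmerLayer κ n →+ AddCircle (1 : ℚ),
      (∀ n (y t : W.selmerLayer κ n), pair n y t = -pair n t y) ∧
      (∀ n (y t y' t' : W.selmerLayer κ n),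
        (y' : W.subgroupH1 p (κ.layerSubgroup n)) = W.conjH1 p (κ.layerSubgroup n) γ y →
        (t' : W.subgroupH1 p (κ.layerSubgroup n)) = W.conjH1 p (κ.layerSubgroup n) γ t → pair n y' t' = pair n y t) ∧
      (∀ n (t : W.selmerLayer κ n), (∀ y, pair n y t = 0) →
        ∃ t' : W.selmerLayer κ n, (∀ y, pair n y t' = 0) ∧ p • t' = t) ∧
      (∀ n (g : W.selmerLayer κ n →+ AddCircle (1 : ℚ)),
        (∀ t, (∀ y, pair n y t = 0) → g t = 0) → ∃ c, ∀ y, g y = pair n y c) ∧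
      (∀ n (t : W.selmerLayer κ (n + 1)) (t' : W.selmerLayer κ n) (y : W.selmerLayer κ n) (y' : W.selmerLayer κ (n + 1)),
        (t' : W.subgroupH1 p (κ.layerSubgroup n)) = W.coresLayer p κ n (t : W.subgroupH1 p (κ.layerSubgroup (n + 1))) →
        (y' : W.subgroupH1 p (κ.layerSubgroup (n + 1))) = W.resOfLe p (κ.layerSubgroup_antitone (Nat.le_succ n)) y →
        pair n y t' = pair (n + 1) y' t)) :
    Greenberg1999.prop414_noFiniteSubmodule_of_not_dvd_torsionOrder := by
  intro W _ _ p _ htors κ γ hκ hγ D _ hD N hN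
  obtain ⟨pair, hskew, hinv, hdiv, hsurj, hadj⟩ := hCT W p htors κ γ hκ hγ
  refine SelmerDualData.forall_finite_eq_bot_of_casselsTatePairings W κ hγ (fun P hP ↦ ?_) D hD pair hskew hinv hdiv hsurj
    hadj N hN
  -- `p ∤ #E(ℚ)_tors` ⟹ no rational point of order `p` (Lagrange in `E(ℚ)_tors`)
  by_contra hP0
  exact htors (dvd_torsionOrder_of_nsmul_eq_zero W p (by convert hP) hP0)

end Summit.BirchSwinnertonDyer.BirchSwinnertonDyer.Theorems.TowerHaMa

end
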